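import Literature.NumberTheory.LFunctions.ZetaKernelEvaluation
import Literature.NumberTheory.LFunctions.KadiriDigammaBounds
import Mathlib.Analysis.Real.Pi.Bounds
import Mathlib.NumberTheory.Harmonic.ZetaAsymp

/-!
# `SignCone.ConeMagnification`, line `Sketch`: the constant weight is NOT Carathéodory-admissible —
# the calibration's `Ω₊`-statement for `Re ζ`, discharged by a kernel-checked evaluation of `ζ`
(crux stmt-RiemannHypothesis-16303; HELPER file, `--supports`)

The calibration of the open core (`exists_large_re_riemannZeta0_of_stub_torusOfCara`, p132538; r4 form p134800) says:
`stub_torusOfCara ⟹ ∃ s, Re s > 1/2 ∧ 1/2 + Re(1/s) + ½ Re ψ(s/2) − ½ log π < Re(ζ₀(s) − 1)`, i.e. the constant weight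
`𝟙_{n≥2}` (whose torus functional exceeds `1/2`) must VIOLATE the Carathéodory majorant somewhere.  Here we prove that
conclusion OUTRIGHT, so that `c ≡ 𝟙` is certified NOT to be a counterexample to the stub:

* `re_riemannZeta_s₀_gt` — `Re ζ(51/100 + 2767/100·i) > 14/5` (true value `2.824…`, next to the Gram point `g₂ = 27.67`), by the
  tree's kernel-evaluable certified Euler–Maclaurin evaluator (`ZetaNumerics.zetaBoxK`, `mem_zetaBoxK`; `decide +kernel`, standard
  axioms, ≈ 10 s), pattern of `Literature/Barriers/RiemannHypothesis/DeBrangesPositivityHE.lean` §2–3;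
* `caraMajorant_s₀_le` — at `s₀ = 51/100 + 2767/100·i`, `1/2 + Re(1/s₀) + ½Re ψ(s₀/2) − ½log π ≤ 34/25` (Kadiri's
  `re_digamma_le`, `log(2767/200) ≤ 4 log 2 + (2767/3200 − 1)`, `log 2 < 0.6931471808`, `π < 3.141593`, `log π > 1`);
* `exists_large_re_riemannZeta0` — `∃ s, Re s > 1/2 ∧ majorant(s) < Re(ζ₀(s) − 1)`;
* `constWeight_not_caraAdmissible` — the Carathéodory hypothesis of `stub_torusOfCara` FAILS for `c ≡ 𝟙` (`F = ζ₀ − 1`).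
-/

open Complex Literature.NumberTheory.LFunctions
open Literature.Analysis.ValidatedNumerics.NumericsMP Literature.NumberTheory.LFunctions.ZetaNumerics

-- `Summit.RiemannHypothesis.RiemannHypothesis.…` repeats a namespace component by design (D-0017 layout).
set_option linter.dupNamespace false

namespace Summit.RiemannHypothesis.RiemannHypothesis.Theorems.SignConeConeMagnification

/-! ## 1. The certificate: `Re ζ(51/100 + 2767/100 i) > 14/5` -/

/-! The evaluation point is `s₀ = 51/100 + 2767/100 i` (just right of the critical line at the height of the Gram
point `g₂ = 27.670…`, where `ζ(1/2 + i g₂) = 2.83…` is real), written out literally below (no definition, no notation). -/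

/-- **The kernel accepts the certificate** (`decide +kernel`, standard axioms: interval tables at scale `2^80` with
`N = 64`, `ν = 14`, one Euler–Maclaurin evaluation of `ζ` on the point box `{s₀}`, and the comparison
`hi [14/5] < lo Re ζ(s₀)`). [folklore] -/
theorem constWeightCert_eq_true :
    (match mkTablesK (2 ^ 80) 64 14 10 95 22 16 8 16 8 with
      | none => false
      | some T =>
        match zetaBoxK T ⟨MI.ofFrac (2 ^ 80) 51 100, MI.ofFrac (2 ^ 80) 2767 100⟩ with
        | some Z => decide ((MI.ofFrac (2 ^ 80) 14 5).hi < Z.re.lo)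
        | none => false) = true := by
  decide +kernel

/-- `s₀` lies in the point box `⟨[51/100], [2767/100]⟩` at scale `2^80`. [folklore] -/
lemma mem_pointBox_s₀ :
    MC.mem (2 ^ 80) (((51 / 100 : ℝ) : ℂ) + ((2767 / 100 : ℝ) : ℂ) * Complex.I) ⟨MI.ofFrac (2 ^ 80) 51 100, MI.ofFrac (2 ^ 80) 2767 100⟩ := by
  refine ⟨?_, ?_⟩
  · have := MI.mem_ofFrac (2 ^ 80) 51 (q := 100) (by norm_num)
    simp only [Complex.add_re, Complex.ofReal_re, Complex.mul_re, Complex.I_re, Complex.ofReal_im,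
      Complex.I_im, mul_zero, zero_mul, sub_zero, add_zero]
    norm_num at this ⊢
    exact this
  · have := MI.mem_ofFrac (2 ^ 80) 2767 (q := 100) (by norm_num)
    simp only [Complex.add_im, Complex.ofReal_im, Complex.mul_im, Complex.I_re, Complex.ofReal_re,
      Complex.I_im, mul_zero, mul_one, zero_add, add_zero]
    norm_num at this ⊢
    exact this

/-- **`Re ζ(s₀) > 14/5`** (soundness of the certificate: `mkTablesK_valid`, `mem_zetaBoxK`, `MI.lt_of_hi_lt_lo`). [folklore] -/
theorem re_riemannZeta_s₀_gt : (14 / 5 : ℝ) < (riemannZeta (((51 / 100 : ℝ) : ℂ) + ((2767 / 100 : ℝ) : ℂ) * Complex.I)).re := by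
  have h := constWeightCert_eq_true
  split at h
  · exact absurd h Bool.false_ne_true
  · rename_i T hT
    split at h
    · rename_i Z hZ
      simp only [decide_eq_true_eq] at h
      have hV : T.Valid := mkTablesK_valid hT
      have hTS : T.S = 2 ^ 80 := mkTablesK_S hT
      have hne1 : (((51 / 100 : ℝ) : ℂ) + ((2767 / 100 : ℝ) : ℂ) * Complex.I) ≠ 1 := fun h1 => by
        have := congrArg Complex.im h1
        simp at this
      have hz : MC.mem (2 ^ 80) (riemannZeta (((51 / 100 : ℝ) : ℂ) + ((2767 / 100 : ℝ) : ℂ) * Complex.I)) Z := by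
        have hb : MC.mem T.S (((51 / 100 : ℝ) : ℂ) + ((2767 / 100 : ℝ) : ℂ) * Complex.I) ⟨MI.ofFrac (2 ^ 80) 51 100, MI.ofFrac (2 ^ 80) 2767 100⟩ := by
          rw [hTS]; exact mem_pointBox_s₀
        have := mem_zetaBoxK hV hb hne1 hZ
        rwa [hTS] at this
      have hq := MI.mem_ofFrac (2 ^ 80) 14 (q := 5) (by norm_num)
      have hlt := MI.lt_of_hi_lt_lo hq hz.1 h
      calc (14 / 5 : ℝ) = ((14 : ℤ) : ℝ) / ((5 : ℕ) : ℝ) := by norm_num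
        _ < _ := hlt
    · exact absurd h Bool.false_ne_true

/-- `Re s₀ = 51/100`. [folklore] -/
lemma s₀_re : ((((51 / 100 : ℝ) : ℂ) + ((2767 / 100 : ℝ) : ℂ) * Complex.I)).re = 51 / 100 := by simp

/-- `Im s₀ = 2767/100`. [folklore] -/
lemma s₀_im : ((((51 / 100 : ℝ) : ℂ) + ((2767 / 100 : ℝ) : ℂ) * Complex.I)).im = 2767 / 100 := by simp

/-! ## 2. The archimedean majorant at `s₀` -/

/-- `log(2767/200) ≤ 2.638`: `log Y = 4 log 2 + log(Y/16) ≤ 4·0.6931471808 + (Y/16 − 1)`. [folklore] -/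
lemma log_Y_le : Real.log (2767 / 200 : ℝ) ≤ 2.638 := by
  have h2 := Real.log_two_lt_d9
  have hY : (2767 / 200 : ℝ) = 2 ^ 4 * (2767 / 3200) := by norm_num
  have hl : Real.log (2767 / 3200 : ℝ) ≤ 2767 / 3200 - 1 := Real.log_le_sub_one_of_pos (by norm_num)
  rw [hY, Real.log_mul (by norm_num) (by norm_num), Real.log_pow]
  push_cast
  linarith

/-- **The Carathéodory majorant at `s₀` is at most `34/25`:**
`1/2 + Re(1/s₀) + ½ Re ψ(s₀/2) − ½ log π ≤ 34/25` (Kadiri's bound `Re ψ(X+iY) ≤ log Y + X²/(2Y²) − X/(2(X²+Y²)) + 1/(6Y³) + π/(12Y²)`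
at `X = 51/200`, `Y = 2767/200`; `log π > 1`). [folklore] -/
theorem caraMajorant_s₀_le :
    1 / 2 + (1 / (((51 / 100 : ℝ) : ℂ) + ((2767 / 100 : ℝ) : ℂ) * Complex.I)).re + (Complex.digamma ((((51 / 100 : ℝ) : ℂ) + ((2767 / 100 : ℝ) : ℂ) * Complex.I) / 2)).re / 2 - Real.log Real.pi / 2 ≤ 34 / 25 := by
  -- `Re(1/s₀) ≤ 1/1000`
  have h1 : (1 / (((51 / 100 : ℝ) : ℂ) + ((2767 / 100 : ℝ) : ℂ) * Complex.I)).re ≤ 1 / 1000 := by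
    rw [one_div, Complex.inv_re, Complex.normSq_apply, s₀_re, s₀_im]
    norm_num
  -- the digamma term
  have hψ : (Complex.digamma ((((51 / 100 : ℝ) : ℂ) + ((2767 / 100 : ℝ) : ℂ) * Complex.I) / 2)).re ≤ 2.641 := by
    have hX : (0 : ℝ) < 51 / 200 := by norm_num
    have hY : (0 : ℝ) < 2767 / 200 := by norm_num
    have h := KadiriDigamma.re_digamma_le hX hY
    have e : ((51 / 200 : ℝ) : ℂ) + (2767 / 200 : ℝ) * I = (((51 / 100 : ℝ) : ℂ) + ((2767 / 100 : ℝ) : ℂ) * Complex.I) / 2 := by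
      push_cast
      ring
    rw [e] at h
    have hπ := Real.pi_lt_d6
    have hl := log_Y_le
    have hA : (51 / 200 : ℝ) ^ 2 / (2 * (2767 / 200 : ℝ) ^ 2) ≤ 0.0002 := by norm_num
    have hB : -((51 / 200 : ℝ) / (2 * ((51 / 200 : ℝ) ^ 2 + (2767 / 200 : ℝ) ^ 2))) ≤ 0 := by
      have : (0 : ℝ) ≤ (51 / 200 : ℝ) / (2 * ((51 / 200 : ℝ) ^ 2 + (2767 / 200 : ℝ) ^ 2)) := by positivity
      linarith
    have hC : 1 / (6 * (2767 / 200 : ℝ) ^ 3) ≤ 0.0001 := by norm_num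
    have hD : Real.pi / (12 * (2767 / 200 : ℝ) ^ 2) ≤ 0.0014 := by
      rw [div_le_iff₀ (by norm_num)]
      linarith
    linarith
  -- `log π > 1`
  have hlogπ : 1 < Real.log Real.pi := by
    rw [← Real.exp_lt_exp, Real.exp_log Real.pi_pos]
    have := Real.exp_one_lt_d9
    linarith [Real.pi_gt_three]
  linarith

/-! ## 3. The `Ω₊`-statement and non-admissibility of the constant weight -/

/-- `Re(ζ₀(s₀) − 1) > 9/5`: `ζ₀ = ζ − 1/(s−1)` and `Re(1/(s₀−1)) < 0`. [folklore] -/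
theorem re_riemannZeta0_s₀_sub_one_gt : (9 / 5 : ℝ) < (riemannZeta₀ (((51 / 100 : ℝ) : ℂ) + ((2767 / 100 : ℝ) : ℂ) * Complex.I) - 1).re := by
  have hne : (((51 / 100 : ℝ) : ℂ) + ((2767 / 100 : ℝ) : ℂ) * Complex.I) ≠ 1 := fun h => by
    have := congrArg Complex.im h
    rw [s₀_im] at this
    norm_num at this
  have hζ := re_riemannZeta_s₀_gt
  have h0 : riemannZeta₀ (((51 / 100 : ℝ) : ℂ) + ((2767 / 100 : ℝ) : ℂ) * Complex.I) = riemannZeta (((51 / 100 : ℝ) : ℂ) + ((2767 / 100 : ℝ) : ℂ) * Complex.I) - ((((51 / 100 : ℝ) : ℂ) + ((2767 / 100 : ℝ) : ℂ) * Complex.I) - 1)⁻¹ := by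
    rw [riemannZeta_eq_inv_sub_add hne]
    ring
  have hinv : (((((51 / 100 : ℝ) : ℂ) + ((2767 / 100 : ℝ) : ℂ) * Complex.I) - 1)⁻¹).re ≤ 0 := by
    rw [Complex.inv_re, Complex.normSq_apply, Complex.sub_re, Complex.sub_im, s₀_re, s₀_im, Complex.one_re,
      Complex.one_im]
    norm_num
  rw [h0, Complex.sub_re, Complex.sub_re, Complex.one_re]
  linarith

/-- **The calibration's `Ω₊`-statement, proved outright**: there is a point `s` with `Re s > 1/2` at which
`Re(ζ₀(s) − 1)` exceeds the Carathéodory majorant `1/2 + Re(1/s) + ½ Re ψ(s/2) − ½ log π` (namely `s = s₀`: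
`9/5 > 34/25`). [folklore] -/
theorem exists_large_re_riemannZeta0 :
    ∃ s : ℂ, 1 / 2 < s.re ∧
      1 / 2 + (1 / s).re + (Complex.digamma (s / 2)).re / 2 - Real.log Real.pi / 2 < (riemannZeta₀ s - 1).re := by
  refine ⟨(((51 / 100 : ℝ) : ℂ) + ((2767 / 100 : ℝ) : ℂ) * Complex.I), by rw [s₀_re]; norm_num, ?_⟩
  have h1 := caraMajorant_s₀_le
  have h2 := re_riemannZeta0_s₀_sub_one_gt
  linarith

/-- **The constant weight `𝟙_{n ≥ 2}` is not Carathéodory-admissible**: its continuation datum `F = ζ₀ − 1`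
(`= L_𝟙(s) − 1/(s−1)`) violates `Re F(s) ≤ 1/2 + Re(1/s) + ½ Re ψ(s/2) − ½ log π` at `s = s₀`.  So `c ≡ 𝟙` (whose torus
functional exceeds `1/2`, `one_half_lt_torusSum_constWeight`) is not a counterexample to `stub_torusOfCara`. [folklore] -/
theorem constWeight_not_caraAdmissible :
    ¬ (∀ s : ℂ, 1 / 2 < s.re →
        (riemannZeta₀ s - 1).re ≤ 1 / 2 + (1 / s).re + (Complex.digamma (s / 2)).re / 2 - Real.log Real.pi / 2) := by
  intro h
  obtain ⟨s, hs, hlt⟩ := exists_large_re_riemannZeta0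
  exact absurd (h s hs) (not_le.2 hlt)

end Summit.RiemannHypothesis.RiemannHypothesis.Theorems.SignConeConeMagnification
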